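import Summits.BirchSwinnertonDyer.Rank1Residual.Additive.TypeGThree
import HarnessLib

/-!
# Additive classes X3/X4 at `p = 3`: the `3`-adic data of a good model of `E` over ANY number field
# at a prime `𝔓 ∣ 3` with `N(𝔓) = 3`, `e(𝔓|3) = 2` (Tate's algorithm for tame `I₀*`, step 2, general `K`)

HONEST FRAMING (cell `b2b-bsdres`, run/shared/lean/b2b/bsd-rank1-residual/, verbatim in every
file): the goal of the cell is to DELETE the COMBINATION-SHAPED residual classes of the
Birch–Swinnerton-Dyer formula for ALL analytic-rank `≤ 1` elliptic curves over `ℚ` — "full BSD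
formula for every rank `≤ 1` curve in class `C`" assembled STRICTLY from published theorems — so
that the rank-`≤ 1` remainder becomes exactly the CONSTRUCTION-SHAPED classes, which are TYPED
(missing-input `Prop`s), NOT attempted. This is not "finishing BSD". Sub-cell `additive-p2`
(CLASS-OWNERS row "X3/X4 additive — pot. good ordinary / X3♯(G-ord)"), generation 8: research
route; no claim beyond the stated classes; theorems only, no definition, no named fact;
X3♯(G-ord)/X4♯(G-ord) stay CONSTRUCTION-SHAPED.

WHAT THIS FILE DOES. Gen 7's `ThreeAdicModel.lean` extracts, from a good model of `E_K` above `3`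
for `K = ℚ(ζ₃)`, a RATIONAL `ρ` with `ord₃(b₂ + 12ρ) ≥ k`, `ord₃(b₄ + ρb₂ + 6ρ²) ≥ 2k`,
`ord₃(b₆ + 2ρb₄ + ρ²b₂ + 4ρ³) ≥ 3k`, `6k = ord₃ Δ_min` — using only two facts about `K`: the
residue field of `K_𝔓` is `𝔽₃` and `e(𝔓|3) = 2`. This file states the same extraction for ANY
number field `K` and prime `𝔓 ∣ 3` with `N(𝔓) = 3` and `e(𝔓|3) = 2` (proofs verbatim):
`exists_int_valued_sub_lt_one_of_absNorm_eq_three`, `valued_algebraMap_rat_eq_sq_of_ramificationIdx_eq_two`,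
**`exists_rat_of_hasGoodReductionAt_baseChange_three_of_ramified`**; and the two conclusions of
`TypeGThree.lean` from the extracted DATA alone (proofs verbatim, first line replaced):
`padicValInt_minimalDiscriminantInt_le_six_of_threeAdicData` (`k ≤ 1` by minimality at `3`) and
**`hasGoodReductionAtPrime_twist_three_of_threeAdicData`** (`k = 1`: the model
`(3, −3ρ, 0, 0) • W^{(−3)}` is good). Consumer: `QuadraticFieldCriterionThree.lean` — over EVERY
quadratic field `K` ramified at `3`, `E_K` good above `3` iff `TypeG W 3` (gen 7 NEXT (a)).

References: J. Tate, LNM 476 (1975) §§7–8; J. H. Silverman, *AEC* III.1 Table 3.1, VII.1, VII.5.1.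
-/

noncomputable section

open scoped Classical NumberField

open WeierstrassCurve IsDedekindDomain IsDedekindDomain.HeightOneSpectrum NumberField IsLocalRing
  WithZero Literature.NumberTheory.EllipticCurves Literature.NumberTheory.EllipticCurves.Rank1Residual

namespace Summit.BirchSwinnertonDyer.Rank1Residual.Additive

/-! ### Residue field `𝔽₃` -/

section Residue

variable {K : Type} [Field K] [NumberField K]

/-- **Every `𝔓`-adic integer of `K_𝔓` is congruent to `0`, `1` or `−1` when `N(𝔓) = 3`** (residue
field of the completion = `𝔽₃`, `natCard_residueField_adicCompletionIntegers_eq_three`; `ȳ³ = ȳ`,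
`𝔪` prime). Gen 7's `exists_int_valued_sub_lt_one` is the case `K = ℚ(ζ₃)`. [folklore] -/
theorem exists_int_valued_sub_lt_one_of_absNorm_eq_three (𝔓 : HeightOneSpectrum (𝓞 K))
    (hN : Ideal.absNorm 𝔓.asIdeal = 3) (x : 𝔓.adicCompletion K) (hx : Valued.v x ≤ 1) :
    ∃ c : ℤ, Valued.v (x - (c : 𝔓.adicCompletion K)) < 1 := by
  set R := 𝔓.adicCompletionIntegers K with hR
  have hk : Nat.card (ResidueField R) = 3 := natCard_residueField_adicCompletionIntegers_eq_three 𝔓 hN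
  haveI : Finite (ResidueField R) := Nat.finite_of_card_ne_zero (by rw [hk]; norm_num)
  letI : Fintype (ResidueField R) := Fintype.ofFinite _
  have hcard : Fintype.card (ResidueField R) = 3 := by rw [Fintype.card_eq_nat_card, hk]
  let y : R := ⟨x, (mem_adicCompletionIntegers (𝓞 K) K 𝔓).mpr hx⟩
  have hy : (y : 𝔓.adicCompletion K) = x := rfl
  have hpow : residue R y ^ 3 = residue R y := by rw [← hcard]; exact FiniteField.pow_card _
  have hmem : y * (y - 1) * (y + 1) ∈ maximalIdeal R := by
    rw [← residue_eq_zero_iff, show y * (y - 1) * (y + 1) = y ^ 3 - y by ring, map_sub, map_pow,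
      hpow, sub_self]
  have key : ∀ z : R, z ∈ maximalIdeal R → Valued.v (z : 𝔓.adicCompletion K) < 1 := fun z hz ↦
    Valuation.Integer.not_isUnit_iff_valuation_lt_one.mp ((IsLocalRing.mem_maximalIdeal z).mp hz)
  rcases (Ideal.IsPrime.mem_or_mem inferInstance hmem) with h | h
  · rcases (Ideal.IsPrime.mem_or_mem inferInstance h) with h' | h'
    · exact ⟨0, by simpa [hy] using key y h'⟩
    · refine ⟨1, ?_⟩
      have := key _ h'
      simpa [hy] using this
  · refine ⟨-1, ?_⟩
    have := key _ h
    simpa [hy, sub_neg_eq_add] using this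


end Residue

/-! ### Extraction over any `K` with `N(𝔓) = 3`, `e(𝔓|3) = 2` -/

section Extraction

variable {K : Type} [Field K] [NumberField K]
  (W : WeierstrassCurve ℚ) [W.IsElliptic] [W.IsGloballyMinimal]

/-- **The valuation of `K_𝔓` restricted to `ℚ` is the SQUARE of the `3`-adic valuation** for ANY
number field `K` and prime `𝔓 ∣ 3` with `e(𝔓|3) = 2` (Mathlib `valuation_liesOver`,
`valuedAdicCompletion_eq_valuation'`); gen 7's `valued_algebraMap_rat_eq_sq` is the case
`K = ℚ(ζ₃)`. [folklore] -/
theorem valued_algebraMap_rat_eq_sq_of_ramificationIdx_eq_two (𝔓 : HeightOneSpectrum (𝓞 K))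
    (h3 : ((3 : ℕ) : 𝓞 K) ∈ 𝔓.asIdeal)
    (he2 : (Ideal.span {((3 : ℕ) : ℤ)}).ramificationIdx' 𝔓.asIdeal = 2) (q : ℚ) :
    Valued.v (algebraMap K (𝔓.adicCompletion K) (algebraMap ℚ K q)) = Rat.padicValuation 3 q ^ 2 := by
  -- the place of `ℤ` below `𝔓` is `(3)`
  set v : HeightOneSpectrum ℤ := (Rat.HeightOneSpectrum.primesEquiv (R := ℤ)).symm ⟨3, Nat.prime_three⟩
    with hvdef
  have hv : Rat.HeightOneSpectrum.natGenerator v = 3 :=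
    congrArg Subtype.val
      ((Rat.HeightOneSpectrum.primesEquiv (R := ℤ)).apply_symm_apply ⟨3, Nat.prime_three⟩)
  have hvspan : v.asIdeal = Ideal.span {((3 : ℕ) : ℤ)} := by
    rw [Rat.HeightOneSpectrum.asIdeal_eq_span_natGenerator_int, hv]
  haveI hlies' : 𝔓.asIdeal.LiesOver (Ideal.span {((3 : ℕ) : ℤ)}) :=
    Ideal.liesOver_span_of_natCast_mem' Nat.prime_three h3
  haveI hlies : 𝔓.asIdeal.LiesOver v.asIdeal := by rw [hvspan]; exact hlies'
  -- `e(𝔓|3) = 2`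
  have hbot : v.asIdeal ≠ ⊥ := v.ne_bot
  have he : v.asIdeal.ramificationIdx' 𝔓.asIdeal = 2 := by rw [hvspan]; exact he2
  -- `v`-adic valuation on `ℚ` is the `3`-adic one
  have hvq : v.valuation ℚ q = Rat.padicValuation 3 q := by
    by_cases hq : q = 0
    · rw [hq, map_zero, map_zero]
    · rw [Rat.HeightOneSpectrum.valuation_eq_exp_neg_padicValRat v hq, hv,
        padicValuation_three_apply hq]
  rw [valued_algebraMap_adicCompletion, ← valuation_liesOver (K := ℚ) (L := K) v 𝔓 q, he, hvq]

/-- **Extraction, any `K`.** If `E_K` has good reduction at a prime `𝔓 ∣ 3` of `K` with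
`N(𝔓) = 3` and `e(𝔓|3) = 2` (e.g. the prime above `3` of ANY quadratic field ramified at `3`), then with
`6 k = ord₃ Δ_min(E)` there is a RATIONAL `ρ`, `3`-integral, such that
`ord₃(b₂ + 12ρ) ≥ k`, `ord₃(b₄ + ρb₂ + 6ρ²) ≥ 2k`, `ord₃(b₆ + 2ρb₄ + ρ²b₂ + 4ρ³) ≥ 3k` (`b_i` the
`b`-invariants of the globally minimal `W`). The good `𝒪_𝔓`-model upstairs is
`(u, r, s, t) • W` with `v(u)¹² = v(Δ_W) = v₃(Δ_W)²`, so `v(u) = exp(−k)` with `6k = ord₃ Δ_W`, and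
its `b`-invariants are integral (Silverman *AEC* III.1 Table 3.1, VII.1); the `3`-adic lift
`ThreeAdicLift.exists_rat_of_integrality` replaces `r ∈ K_𝔓` by a rational `ρ`. Verbatim gen 7's
`exists_rat_of_hasGoodReductionAt_baseChange_three` with the two `K`-facts as hypotheses. -/
theorem exists_rat_of_hasGoodReductionAt_baseChange_three_of_ramified (𝔓 : HeightOneSpectrum (𝓞 K))
    (h3 : ((3 : ℕ) : 𝓞 K) ∈ 𝔓.asIdeal) (hN : Ideal.absNorm 𝔓.asIdeal = 3)
    (he2 : (Ideal.span {((3 : ℕ) : ℤ)}).ramificationIdx' 𝔓.asIdeal = 2)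
    (hgood : (W.baseChange K).HasGoodReductionAt 𝔓) :
    ∃ (k : ℕ) (ρ : ℚ), padicValInt 3 (minimalDiscriminantInt W) = 6 * k ∧
      Rat.padicValuation 3 ρ ≤ 1 ∧
      Rat.padicValuation 3 (W.b₂ + 12 * ρ) ≤ exp (-(k : ℤ)) ∧
      Rat.padicValuation 3 (W.b₄ + ρ * W.b₂ + 6 * ρ ^ 2) ≤ exp (-(2 * k : ℤ)) ∧
      Rat.padicValuation 3 (W.b₆ + 2 * ρ * W.b₄ + ρ ^ 2 * W.b₂ + 4 * ρ ^ 3) ≤ exp (-(3 * k : ℤ)) := by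
  set L := 𝔓.adicCompletion K with hLdef
  set ι : ℚ →+* L := (algebraMap K L).comp (algebraMap ℚ K) with hιdef
  have hι : ∀ q : ℚ, Valued.v (ι q) = Rat.padicValuation 3 q ^ 2 := fun q ↦
    valued_algebraMap_rat_eq_sq_of_ramificationIdx_eq_two 𝔓 h3 he2 q
  -- the good model upstairs
  haveI : (W.baseChange K).IsElliptic := by rw [baseChange]; infer_instance
  obtain ⟨C, M, hCM, hMΔ⟩ := (W.baseChange K).exists_integralModel_of_hasGoodReductionAt hgood
  set X : WeierstrassCurve L := (W.baseChange K).baseChange L with hXdef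
  have hXb₂ : X.b₂ = ι W.b₂ := by
    rw [hXdef, baseChange, map_b₂, baseChange, map_b₂, hιdef, RingHom.comp_apply]
  have hXb₄ : X.b₄ = ι W.b₄ := by
    rw [hXdef, baseChange, map_b₄, baseChange, map_b₄, hιdef, RingHom.comp_apply]
  have hXb₆ : X.b₆ = ι W.b₆ := by
    rw [hXdef, baseChange, map_b₆, baseChange, map_b₆, hιdef, RingHom.comp_apply]
  have hXΔ : X.Δ = ι W.Δ := by
    rw [hXdef, baseChange, map_Δ, baseChange, map_Δ, hιdef, RingHom.comp_apply]
  have hint : ∀ m : 𝔓.adicCompletionIntegers K,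
      Valued.v (algebraMap (𝔓.adicCompletionIntegers K) L m) ≤ 1 := fun m ↦
    (mem_adicCompletionIntegers (𝓞 K) K 𝔓).mp m.2
  have hCb₂ : Valued.v ((C • X).b₂) ≤ 1 := by rw [hCM, map_b₂]; exact hint _
  have hCb₄ : Valued.v ((C • X).b₄) ≤ 1 := by rw [hCM, map_b₄]; exact hint _
  have hCb₆ : Valued.v ((C • X).b₆) ≤ 1 := by rw [hCM, map_b₆]; exact hint _
  have hCΔ : Valued.v ((C • X).Δ) = 1 := by
    rw [hCM, map_Δ]
    exact (Valuation.Integers.isUnit_iff_valuation_eq_one (Valuation.integer.integers _)).mp hMΔ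
  have hu0 : (C.u : L) ≠ 0 := C.u.ne_zero
  -- `v(u)¹² = v(Δ_W) = v₃(Δ_W)²`
  have hΔ0 : W.Δ ≠ 0 := W.isUnit_Δ.ne_zero
  have hvu0 : Valued.v (C.u : L) ≠ 0 := (Valuation.ne_zero_iff _).mpr hu0
  have hvXΔ : Valued.v X.Δ = Valued.v (C.u : L) ^ 12 := by
    rw [variableChange_Δ, Units.val_inv_eq_inv_val, map_mul, map_pow, map_inv₀] at hCΔ
    calc Valued.v X.Δ
        = Valued.v (C.u : L) ^ 12 * ((Valued.v (C.u : L))⁻¹ ^ 12 * Valued.v X.Δ) := by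
          rw [← mul_assoc, ← mul_pow, mul_inv_cancel₀ hvu0, one_pow, one_mul]
      _ = Valued.v (C.u : L) ^ 12 := by rw [hCΔ, mul_one]
  have hvΔ : Valued.v (C.u : L) ^ 12 = Rat.padicValuation 3 W.Δ ^ 2 := by
    rw [← hι, ← hXΔ, hvXΔ]
  -- `k` with `6k = ord₃ Δ_min` and `v(u) = exp(−k)`
  set n : ℕ := padicValInt 3 (minimalDiscriminantInt W) with hndef
  have hvΔ' : Rat.padicValuation 3 W.Δ = exp (-(n : ℤ)) := by
    rw [padicValuation_three_apply hΔ0, padicValRat_Δ_eq W 3]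
  set a : ℤ := log (Valued.v (C.u : L)) with hadef
  have hua : Valued.v (C.u : L) = exp a := (exp_log hvu0).symm
  have h12 : 12 * a = -(2 * n : ℤ) := by
    rw [hua, hvΔ', ← exp_nsmul, ← exp_nsmul, exp_inj] at hvΔ
    simp only [nsmul_eq_mul] at hvΔ
    push_cast at hvΔ
    linarith
  obtain ⟨k, hk⟩ : ∃ k : ℕ, (n : ℤ) = 6 * k ∧ a = -(k : ℤ) :=
    ⟨n / 6, by omega, by omega⟩
  have huk : Valued.v (C.u : L) = exp (-(k : ℤ)) := by rw [hua, hk.2]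
  -- the three integrality conditions on `r = C.r`
  have hB₂ : Valued.v (ι W.b₂ + 12 * C.r) ≤ exp (-(2 * k : ℤ)) := by
    have h' : Valued.v ((C.u : L)⁻¹ ^ 2 * (ι W.b₂ + 12 * C.r)) ≤ 1 := by
      rw [← hXb₂, ← Units.val_inv_eq_inv_val, ← variableChange_b₂]; exact hCb₂
    have h := valuation_le_pow_of_inv_pow_mul_le_one Valued.v hu0 h'
    rw [huk, ← exp_nsmul] at h
    convert h using 2; simp only [nsmul_eq_mul]; push_cast; ring
  have hB₄ : Valued.v (ι W.b₄ + C.r * ι W.b₂ + 6 * C.r ^ 2) ≤ exp (-(4 * k : ℤ)) := by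
    have h' : Valued.v ((C.u : L)⁻¹ ^ 4 * (ι W.b₄ + C.r * ι W.b₂ + 6 * C.r ^ 2)) ≤ 1 := by
      rw [← hXb₂, ← hXb₄, ← Units.val_inv_eq_inv_val, ← variableChange_b₄]; exact hCb₄
    have h := valuation_le_pow_of_inv_pow_mul_le_one Valued.v hu0 h'
    rw [huk, ← exp_nsmul] at h
    convert h using 2; simp only [nsmul_eq_mul]; push_cast; ring
  have hB₆ : Valued.v (ι W.b₆ + 2 * C.r * ι W.b₄ + C.r ^ 2 * ι W.b₂ + 4 * C.r ^ 3) ≤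
      exp (-(6 * k : ℤ)) := by
    have h' : Valued.v ((C.u : L)⁻¹ ^ 6 *
        (ι W.b₆ + 2 * C.r * ι W.b₄ + C.r ^ 2 * ι W.b₂ + 4 * C.r ^ 3)) ≤ 1 := by
      rw [← hXb₂, ← hXb₄, ← hXb₆, ← Units.val_inv_eq_inv_val, ← variableChange_b₆]; exact hCb₆
    have h := valuation_le_pow_of_inv_pow_mul_le_one Valued.v hu0 h'
    rw [huk, ← exp_nsmul] at h
    convert h using 2; simp only [nsmul_eq_mul]; push_cast; ring
  -- the `3`-adic lift
  obtain ⟨hb₂, hb₄, hb₆⟩ := padicValuation_b_le_one W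
  have hres : ∀ x : L, Valued.v x ≤ 1 → ∃ c : ℤ, Valued.v (x - ι c) < 1 := fun x hx ↦ by
    obtain ⟨c, hc⟩ := exists_int_valued_sub_lt_one_of_absNorm_eq_three 𝔓 hN x hx
    exact ⟨c, by rwa [map_intCast]⟩
  obtain ⟨ρ, hρ, h₂, h₄, h₆⟩ := ThreeAdicLift.exists_rat_of_integrality Valued.v ι (Rat.padicValuation 3)
    hι (Rat.padicValuation_self 3) (by rw [show (2 : ℚ) = ((2 : ℤ) : ℚ) by norm_num,
      Rat.padicValuation_cast, Int.padicValuation_eq_one_iff]; decide)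
    (fun c ↦ by rw [Rat.padicValuation_cast]; exact Int.padicValuation_le_one 3 c)
    hres hb₂ hb₄ hb₆ hB₂ hB₄ hB₆
  exact ⟨k, ρ, by exact_mod_cast hk.1, hρ, h₂, h₄, h₆⟩

end Extraction

/-! ### The two conclusions of `TypeGThree.lean` from the extracted data alone -/

section Data

variable (W : WeierstrassCurve ℚ) [W.IsElliptic] [W.IsGloballyMinimal]

/-- **`ord₃ Δ_min ∈ {0, 6}` from the `3`-adic data** (`k ≥ 2` would make
`(3, ρ, −a₁/2, −(a₃+ρa₁)/2) • W` a `3`-integral model with discriminant `3⁻¹² Δ_min`, contradicting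
minimality at `3`). Verbatim gen 7's
`padicValInt_minimalDiscriminantInt_le_six_of_hasGoodReductionAt_baseChange_three`, data as
hypotheses. [cite: SilvermanAEC2009, VII.1 Prop. 1.3] -/
theorem padicValInt_minimalDiscriminantInt_le_six_of_threeAdicData {k : ℕ} {ρ : ℚ}
    (hk : padicValInt 3 (minimalDiscriminantInt W) = 6 * k)
    (h₂ : Rat.padicValuation 3 (W.b₂ + 12 * ρ) ≤ exp (-(k : ℤ)))
    (h₄ : Rat.padicValuation 3 (W.b₄ + ρ * W.b₂ + 6 * ρ ^ 2) ≤ exp (-(2 * k : ℤ)))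
    (h₆ : Rat.padicValuation 3 (W.b₆ + 2 * ρ * W.b₄ + ρ ^ 2 * W.b₂ + 4 * ρ ^ 3) ≤ exp (-(3 * k : ℤ))) :
    padicValInt 3 (minimalDiscriminantInt W) = 0 ∨ padicValInt 3 (minimalDiscriminantInt W) = 6 := by
  suffices hk1 : k ≤ 1 by
    interval_cases k
    · left; simpa using hk
    · right; simpa using hk
  by_contra hlt
  rw [not_le] at hlt
  -- the place of `𝓞 ℚ` at `3`; `W` is minimal there
  set u₃ : HeightOneSpectrum (𝓞 ℚ) :=
    (Rat.HeightOneSpectrum.primesEquiv (R := 𝓞 ℚ)).symm ⟨3, Nat.prime_three⟩ with hu₃def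
  have hu₃ : ((3 : ℕ) : 𝓞 ℚ) ∈ u₃.asIdeal :=
    (natCast_mem_asIdeal_iff_eq_primesEquiv_symm u₃ Nat.prime_three).mpr rfl
  have hmin : W.IsMinimalAt u₃ := IsGloballyMinimal.isMinimal u₃
  -- the competing model
  set C : VariableChange ℚ :=
    ⟨Units.mk0 (3 : ℚ) (by norm_num), ρ, -W.a₁ / 2, -(W.a₃ + ρ * W.a₁) / 2⟩ with hCdef
  have hCu : (↑C.u⁻¹ : ℚ) = 3⁻¹ := by rw [Units.val_inv_eq_inv_val, hCdef, Units.val_mk0]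
  have ha₁ : (C • W).a₁ = 0 := by
    rw [variableChange_a₁, hCu, hCdef]; ring
  have ha₃ : (C • W).a₃ = 0 := by
    rw [variableChange_a₃, hCu, hCdef]; ring
  have ha₂ : (C • W).a₂ = (W.b₂ + 12 * ρ) / (3 ^ 2 * (4 : ℤ)) := by
    rw [variableChange_a₂, hCu, hCdef, b₂]; push_cast; ring
  have ha₄ : (C • W).a₄ = (W.b₄ + ρ * W.b₂ + 6 * ρ ^ 2) / (3 ^ 4 * (2 : ℤ)) := by
    rw [variableChange_a₄, hCu, hCdef, b₂, b₄]; push_cast; ring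
  have ha₆ : (C • W).a₆ = (W.b₆ + 2 * ρ * W.b₄ + ρ ^ 2 * W.b₂ + 4 * ρ ^ 3) / (3 ^ 6 * (4 : ℤ)) := by
    rw [variableChange_a₆, hCu, hCdef, b₂, b₄, b₆]; push_cast; ring
  have h4 : ¬ (3 : ℤ) ∣ 4 := by decide
  have h2 : ¬ (3 : ℤ) ∣ 2 := by decide
  have hle : ∀ {x : ℚ} {a : ℤ} {i : ℕ}, Rat.padicValuation 3 x ≤ exp a → a ≤ -(i : ℤ) →
      Rat.padicValuation 3 x ≤ exp (-(i : ℤ)) := fun hx hij ↦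
    le_trans hx (by rwa [exp_le_exp])
  have hint : (C • W).IsIntegralAt u₃ := by
    refine (C • W).isIntegralAt_of_valuation_le_one u₃ ?_ ?_ ?_ ?_ ?_
    · rw [ha₁, map_zero]; exact zero_le
    · rw [ha₂, valuation_le_one_iff_padicValuation_three u₃ hu₃]
      exact padicValuation_three_div_le_one h4 (hle h₂ (by omega))
    · rw [ha₃, map_zero]; exact zero_le
    · rw [ha₄, valuation_le_one_iff_padicValuation_three u₃ hu₃]
      exact padicValuation_three_div_le_one h2 (hle h₄ (by omega))
    · rw [ha₆, valuation_le_one_iff_padicValuation_three u₃ hu₃]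
      exact padicValuation_three_div_le_one h4 (hle h₆ (by omega))
  -- minimality: `u₃(Δ(C • W)) ≤ u₃(Δ W)`, but `Δ(C • W) = 3⁻¹² Δ W`
  have hmono := valuation_Δ_smul_le_of_isMinimalAt u₃ hmin C hint
  rw [variableChange_Δ, hCu, map_mul, map_pow, map_inv₀] at hmono
  have hΔ0 : u₃.valuation ℚ W.Δ ≠ 0 := (Valuation.ne_zero_iff _).mpr W.isUnit_Δ.ne_zero
  have h3lt : u₃.valuation ℚ (3 : ℚ) < 1 := by
    haveI : Fact (Nat.Prime ((Rat.HeightOneSpectrum.primesEquiv u₃ : Nat.Primes) : ℕ)) :=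
      ⟨(Rat.HeightOneSpectrum.primesEquiv u₃).2⟩
    have hq : ((Rat.HeightOneSpectrum.primesEquiv u₃ : Nat.Primes) : ℕ) = 3 :=
      Rat.HeightOneSpectrum.primesEquiv_eq_of_natCast_mem u₃ Nat.prime_three hu₃
    rw [(Rat.HeightOneSpectrum.valuation_equiv_padicValuation u₃).lt_one_iff_lt_one,
      padicValuation_apply_of_ne_zero _ (by norm_num : (3 : ℚ) ≠ 0), hq, ← exp_zero, exp_lt_exp,
      show (3 : ℚ) = ((3 : ℕ) : ℚ) by norm_num, padicValRat.self (by norm_num)]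
    norm_num
  have h30 : u₃.valuation ℚ (3 : ℚ) ≠ 0 := (Valuation.ne_zero_iff _).mpr (by norm_num)
  have hone : (u₃.valuation ℚ (3 : ℚ))⁻¹ ^ 12 ≤ 1 := by
    calc (u₃.valuation ℚ (3 : ℚ))⁻¹ ^ 12
        = (u₃.valuation ℚ (3 : ℚ))⁻¹ ^ 12 * u₃.valuation ℚ W.Δ * (u₃.valuation ℚ W.Δ)⁻¹ := by
          rw [mul_inv_cancel_right₀ hΔ0]
      _ ≤ u₃.valuation ℚ W.Δ * (u₃.valuation ℚ W.Δ)⁻¹ := mul_le_mul' hmono le_rfl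
      _ = 1 := mul_inv_cancel₀ hΔ0
  have hge : 1 ≤ u₃.valuation ℚ (3 : ℚ) := by
    rw [inv_pow] at hone
    have h := (inv_le_one₀ (pow_pos (zero_lt_iff.mpr h30) 12)).mp hone
    exact (one_le_pow_iff_of_nonneg zero_le (by norm_num)).mp h
  exact absurd h3lt (not_lt.mpr hge)


/-- **The twist `E^{(−3)}` is good at `3` from the `3`-adic data** (bad reduction at `3` forces
`k = 1`; the `ℚ`-model `(3, −3ρ, 0, 0) • W^{(−3)}` has `3`-integral coefficients and discriminant
`Δ_min/3⁶`, a `3`-adic unit). Verbatim gen 7's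
`hasGoodReductionAtPrime_twist_three_of_hasGoodReductionAt_baseChange`, data as hypotheses.
[cite: SilvermanAEC2009, VII.5 Prop. 5.1(a) and III.1 Table 3.1] -/
theorem hasGoodReductionAtPrime_twist_three_of_threeAdicData {k : ℕ} {ρ : ℚ}
    (hk : padicValInt 3 (minimalDiscriminantInt W) = 6 * k)
    (h₂ : Rat.padicValuation 3 (W.b₂ + 12 * ρ) ≤ exp (-(k : ℤ)))
    (h₄ : Rat.padicValuation 3 (W.b₄ + ρ * W.b₂ + 6 * ρ ^ 2) ≤ exp (-(2 * k : ℤ)))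
    (h₆ : Rat.padicValuation 3 (W.b₆ + 2 * ρ * W.b₄ + ρ ^ 2 * W.b₂ + 4 * ρ ^ 3) ≤ exp (-(3 * k : ℤ)))
    (hbad : ¬ W.HasGoodReductionAtPrime 3)
    (Wd : WeierstrassCurve ℚ) [Wd.IsElliptic] [Wd.IsGloballyMinimal] (C : VariableChange ℚ)
    (hWd : C • W.quadraticTwist ((-1 : ℚ) ^ ((3 : ℕ) / 2) * (3 : ℕ)) = Wd) :
    Wd.HasGoodReductionAtPrime 3 := by
  -- `ord₃ Δ_min = 6`, `k = 1`
  have hn6 : padicValInt 3 (minimalDiscriminantInt W) = 6 := by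
    rcases padicValInt_minimalDiscriminantInt_le_six_of_threeAdicData W hk h₂ h₄ h₆ with h | h
    · exact absurd h (padicValInt_minimalDiscriminantInt_ne_zero_of_not_hasGoodReductionAtPrime W hbad)
    · exact h
  have hk1 : k = 1 := by omega
  subst hk1
  -- the twist and the candidate good model
  rw [pStar_three] at hWd
  set V := W.quadraticTwist (-3 : ℚ) with hVdef
  haveI : NeZero (2 : ℚ) := ⟨two_ne_zero⟩
  haveI hVell : V.IsElliptic := W.isElliptic_quadraticTwist (by norm_num)
  set C' : VariableChange ℚ := ⟨Units.mk0 (3 : ℚ) (by norm_num), -3 * ρ, 0, 0⟩ with hC'def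
  have hC'u : (↑C'.u⁻¹ : ℚ) = 3⁻¹ := by rw [Units.val_inv_eq_inv_val, hC'def, Units.val_mk0]
  have ha₁ : (C' • V).a₁ = 0 := by
    rw [variableChange_a₁, hC'u, hC'def, hVdef, quadraticTwist_a₁]; ring
  have ha₃ : (C' • V).a₃ = 0 := by
    rw [variableChange_a₃, hC'u, hC'def, hVdef, quadraticTwist_a₃, quadraticTwist_a₁]; ring
  have ha₂ : (C' • V).a₂ = (W.b₂ + 12 * ρ) / (3 ^ 1 * (-4 : ℤ)) := by
    rw [variableChange_a₂, hC'u, hC'def, hVdef, quadraticTwist_a₁, quadraticTwist_a₂]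
    push_cast; field_simp; ring
  have ha₄ : (C' • V).a₄ = (W.b₄ + ρ * W.b₂ + 6 * ρ ^ 2) / (3 ^ 2 * (2 : ℤ)) := by
    rw [variableChange_a₄, hC'u, hC'def, hVdef, quadraticTwist_a₁, quadraticTwist_a₂,
      quadraticTwist_a₃, quadraticTwist_a₄]
    push_cast; field_simp; ring
  have ha₆ : (C' • V).a₆ = (W.b₆ + 2 * ρ * W.b₄ + ρ ^ 2 * W.b₂ + 4 * ρ ^ 3) / (3 ^ 3 * (-4 : ℤ)) := by
    rw [variableChange_a₆, hC'u, hC'def, hVdef, quadraticTwist_a₁, quadraticTwist_a₂,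
      quadraticTwist_a₃, quadraticTwist_a₄, quadraticTwist_a₆]
    push_cast; field_simp; ring
  have hΔ' : (C' • V).Δ = W.Δ / (3 ^ 6 * (1 : ℤ)) := by
    rw [variableChange_Δ, hC'u, hVdef, quadraticTwist_Δ]
    push_cast; field_simp
  -- the place of `𝓞 ℚ` at `3`
  set u₃ : HeightOneSpectrum (𝓞 ℚ) :=
    (Rat.HeightOneSpectrum.primesEquiv (R := 𝓞 ℚ)).symm ⟨3, Nat.prime_three⟩ with hu₃def
  have hu₃ : ((3 : ℕ) : 𝓞 ℚ) ∈ u₃.asIdeal :=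
    (natCast_mem_asIdeal_iff_eq_primesEquiv_symm u₃ Nat.prime_three).mpr rfl
  have h4 : ¬ (3 : ℤ) ∣ (-4) := by decide
  have h2 : ¬ (3 : ℤ) ∣ 2 := by decide
  have h1 : ¬ (3 : ℤ) ∣ 1 := by decide
  have hΔv : Rat.padicValuation 3 W.Δ = exp (-((6 : ℕ) : ℤ)) := by
    rw [padicValuation_three_apply W.isUnit_Δ.ne_zero, padicValRat_Δ_eq W 3, hn6]
  have hgoodV' : (C' • V).HasGoodReductionAt u₃ := by
    refine (C' • V).hasGoodReductionAt_of_valuation_le_one_of_valuation_Δ_eq_one u₃ ?_ ?_ ?_ ?_ ?_ ?_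
    · rw [ha₁, map_zero]; exact zero_le
    · rw [ha₂, valuation_le_one_iff_padicValuation_three u₃ hu₃]
      exact padicValuation_three_div_le_one h4 (by simpa using h₂)
    · rw [ha₃, map_zero]; exact zero_le
    · rw [ha₄, valuation_le_one_iff_padicValuation_three u₃ hu₃]
      exact padicValuation_three_div_le_one h2 (by simpa using h₄)
    · rw [ha₆, valuation_le_one_iff_padicValuation_three u₃ hu₃]
      exact padicValuation_three_div_le_one h4 (by simpa using h₆)
    · rw [hΔ', valuation_eq_one_iff_padicValuation_three u₃ hu₃]
      exact padicValuation_three_div_eq_one h1 hΔv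
  have hgoodV : V.HasGoodReductionAt u₃ := (hasGoodReductionAt_smul_iff_holds u₃ V C').mp hgoodV'
  have hgoodWd : Wd.HasGoodReductionAt u₃ := by
    rw [← hWd]
    exact (hasGoodReductionAt_smul_iff_holds u₃ V C).mpr hgoodV
  exact hasGoodReductionAtPrime_of_hasGoodReductionAt Wd u₃ hu₃ hgoodWd

end Data

end Summit.BirchSwinnertonDyer.Rank1Residual.Additive

end
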